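import Summits.ABC.IUTFork.Conditional.FreyLegendreP6EngineInterval
import Literature.IUT.LogVolume.Corollary22FullGaloisImage
import Literature.IUT.LogVolume.Corollary22DegInfBound
import Literature.IUT.LogVolume.Corollary22FreyPoint
import Literature.NumberTheory.DiophantineGeometry.FaltingsHeightJInvariantExplicit
import Literature.NumberTheory.DiophantineGeometry.GenEllLemma35Proofs
import HarnessLib

/-!
# (P6) + INHABITED-DATUM ENGINE v5, ISOGENY–HEIGHT FORM — EVERY prime `l ≥ lo` on a carrier from ONE inequality, NO certificates

PROOF-ONLY file (D-0012; 0 definitions, 0 `Prop` facts, no instance, no notation) of the abc-iut cell (seat abc-iut-w6-d102,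
gen 10; row family «C:P6-N3-BANDS-INH», offer (η) «C:P6-N3-TAIL-ISOGENY-HEIGHT»; line: route-ABC-IUTThetaPilot ▸ stmt-ABC-19678 ▸
RESHAPE-4 ▸ `stub_cor312PerImage`, instrument row = non-vacuity of the (P)-reading binders). The certificate engines v1–v4
(`FreyP6Engine.condP6_ratPoint_of_certificate[_list][_euler]`, `…_interval_euler`, `…_interval_mask`) establish (P6) =
`Cor22.CondP6 (ratPoint λ) l` ONE LEVEL AT A TIME (Mazur's Frobenius certificate + Tate transvection), hence only on finite bands:
"finitely many certificates never serve the infinite INH side". THIS engine serves the infinite side, by tree THEOREMS only: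

* **(A) [GenEll] Lemma 3.5 made EXPLICIT** (`FreyP6Engine.mul_degInf_le_of_admitsLCyclic`): for a presented SEMISTABLE
  elliptic curve `E_F` over any number field and a prime `l` prime to its local heights, if `E_F` admits an `l`-cyclic subgroup
  scheme then `5·l·deg_∞([E_F]) ≤ 8·ht_∞([E_F]) + 48·log l + 313`. Proof = the printed proof of Lemma 3.5 (S. Mochizuki,
  *Arithmetic elliptic curves in general position*, Math. J. Okayama Univ. **52** (2010), p. 17; the tree's
  `GenEll_lemma35_general`), with the two `O(1)`'s of Prop. 3.4 replaced by the tree's EXPLICIT Silverman constants: the quotient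
  `E_H = E/H` (`EllPoint.exists_isogeny_of_admitsLCyclic`) has `deg_∞(E_H) = l·deg_∞(E)`
  (`Isogeny.jDenominatorIdeal_eq_pow_of_degree_eq_prime`) and `ht^Falt(E_H) ≤ ht^Falt(E) + ½·log l` (Faltings,
  `stableFaltingsHeight_le_of_isogeny_holds`); Silverman 1986 Prop. 2.1 with `(C₁, C₂) = (9, 37)`
  (`jHeight_le_stableFaltingsHeight_explicit`: `ht_∞ ≤ 12·ht^Falt + 6·log(1 + ht_∞) + 37`, and `stableFaltingsHeight_le_logHeight₁`:
  `12·ht^Falt ≤ ht_∞ − 9`), `deg_∞ ≤ ht_∞` (`degInf_le_htInf`), and `6·log(1+x) ≤ (3/8)·x + 3/8 − 6 + 24·log 2` (`log y ≤ y − 1` at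
  `y = (1+x)/16`, `log 2 < 0.6931471808`).
* **(B) [IUTchIV] Cor. 2.2 (ii), (P4) ⇒ (P6), FIXED-POINT EXPLICIT form** (`FreyP6Engine.condP6_of_isogenyHeight`): for ANY
  `λ ∈ U_X`, a prime `l ≥ 7` with (P2), (P5) and `8·ht_∞(λ) + 48·log l + 313 < 5·l·log q^∀(λ)`, (P6) holds — for every
  theta-field `F` (Galois, `[F : F_tpd] ∣ 46080`, `E_F` semistable: `IsThetaField`) the dictionary of `Corollary22FullGaloisImage`
  BY NAME (`htInf_eq_htInfty`, `logQForall_le_degInf_thetaEllPoint`, `not_dvd_localHeight_of_condP2`) turns (A) into "no `l`-cyclic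
  subgroup scheme of `E_F`", and the (P5) place carries the Tate transvection (`imageModLContainsSL2_of_condP5` = [GenEll] Lem. 3.1
  (iii)). S. Mochizuki, *Inter-universal Teichmüller theory IV*, proof of Cor. 2.2 (ii), (P4)–(P6), pp. 45–46 — there with an
  ineffective `H_K` over a compactly bounded `K_V` (`Cor22.condP6_of_seven_le`); here pointwise and explicit.
* **(C) TAIL form at the Frey–Legendre point of an abc triple** (`FreyP6Engine.condP6_ratPoint_triple_tail`): with
  `ht_∞(a/c) ≤ 6·log c + log 256` (`htInfty_ratPoint_triple_le`) and `2·log (abc)_odd ≤ log q^{∤2} ≤ log q^∀`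
  (`two_mul_log_oddPart_le_logQNotTwo`, `logQAvoid_anti`), ONE inequality of natural numbers at `l = lo`,
  `2^516·c^48·lo^48 < m^(10·lo)` with `abc = 2^k·m`, `m` odd (`e^313 < 2^452`, `log l ≤ log lo + (l − lo)/lo`), gives (P6) at EVERY prime `l ≥ lo`
  satisfying (P2), (P5); and (`FreyAdm.nonempty_thetaVolumeDatumAt_triple_tail`) with the structural (P2)/(P5)/core of the list
  dictionary (`condP2_triple`, `condP5_triple`, `admitsCore_triple`; `lo` above every exponent of `(abc)²`) and the route's proved
  `ThetaPartII.stub_thetaData`: `∀ l, l.Prime → lo ≤ l → Nonempty (Cor22.ThetaVolumeDatumAt (ratPoint (a/c)) l)` — the WHOLE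
  infinite tail of a carrier's axis in one application, no level list, no `decide` over levels; and
  (`FreyAdm.nonempty_thetaVolumeDatumAt_triple_axis`) the same from `lo = 7` with the honest (P2) exclusion list `Ex` below the
  exponent bound `B` decided once: a carrier's ENTIRE admissible axis `l ≥ 7`, `l ∉ Ex`, in ONE theorem.

HONEST SCOPE: «inhabited» = non-vacuity of OUR typed datum type over OUR containers; the arithmetic is classical (Faltings 1983,
Silverman 1986, the Tate curve) AS TYPED AND PROVED in the tree; Serre's open-image theorem and Mazur's isogeny theorem are NOT used;
inhabited-as-typed ≠ true-in-print; nothing about [IUTchIII] Cor. 3.12 or `S_H`; Szpiro-badness NOT claimed; no side taken on any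
author; typed ≠ proved; no abc claim.
[cite: MochizukiGenEll2010, Lem. 3.5 p. 17; Lem. 3.1 (iii) p. 14] [cite: Silverman1986, Prop. 2.1 (p. 257)]
[cite: Faltings1986FinitenessTranslation, §3] [cite: Mochizuki2012, IUTchIV Cor. 2.2 (ii) proof (P2)(P4)(P5)(P6) pp. 45–46]
[claim: Mochizuki2012, status: disputed] for every IUT sentence quoted.
-/

noncomputable section

open scoped Classical
open WeierstrassCurve

namespace Summit.ABC.IUTFork.Conditional

namespace FreyP6Engine

open NumberField IsDedekindDomain Height
open Literature.NumberTheory.EllipticCurves Literature.NumberTheory.DiophantineGeometry.GenEll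
open Literature.NumberTheory.DiophantineGeometry Literature.IUT.LogVolume Literature.IUT.LogVolume.Cor22
open Literature.NumberTheory.DiophantineGeometry.UniformABCConjecture

/-! ## (A) [GenEll] Lemma 3.5, explicit -/

/-- The elementary absorption of Silverman's logarithm
(`log y ≤ y − 1` at `y = (1+x)/16`, `24·log 2 < 16.64`): `6·log(1 + x) ≤ (3/8)·x + 89/8` for `x ≥ 0`. [folklore] -/
theorem six_mul_log_one_add_le {x : ℝ} (hx : 0 ≤ x) : 6 * Real.log (1 + x) ≤ 3 / 8 * x + 89 / 8 := by
  have h16 : Real.log ((1 + x) / 16) ≤ (1 + x) / 16 - 1 := Real.log_le_sub_one_of_pos (by positivity)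
  rw [Real.log_div (by positivity) (by norm_num)] at h16
  have hl16 : Real.log 16 = 4 * Real.log 2 := by
    rw [show (16 : ℝ) = 2 ^ 4 by norm_num, Real.log_pow]; norm_num
  have h2 := Real.log_two_lt_d9
  linarith

/-- **[GenEll] Lemma 3.5 with EXPLICIT constants.** For a presented semistable elliptic curve `E_F` over a number field, a prime `l`
prime to the local heights of `E` at its primes of multiplicative reduction, if `E_F` admits an `l`-cyclic subgroup scheme then
`5·l·deg_∞([E_F]) ≤ 8·ht_∞([E_F]) + 48·log l + 313`. The printed proof (p. 17: `E_H := E/H`, `deg_∞(E_H) = l·deg_∞(E)`,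
`ht^Falt(E_H) ≤ ht^Falt(E) + ½ log l` by Faltings, then Prop. 3.4) with Prop. 3.4's `≲` replaced by Silverman 1986 Prop. 2.1 in the
tree's explicit form `(C₁, C₂) = (9, 37)`; all inputs are tree theorems (`exists_isogeny_of_admitsLCyclic`,
`Isogeny.jDenominatorIdeal_eq_pow_of_degree_eq_prime`, `stableFaltingsHeight_le_of_isogeny_holds`,
`jHeight_le_stableFaltingsHeight_explicit`, `stableFaltingsHeight_le_logHeight₁`, `degInf_le_htInf`).
[cite: MochizukiGenEll2010, Lem. 3.5 p. 17] [cite: Silverman1986, Prop. 2.1 (p. 257)] -/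
theorem mul_degInf_le_of_admitsLCyclic (P : EllPoint) {l : ℕ} (hl : l.Prime) (hss : P.IsSemistable)
    (hcop : ∀ v : HeightOneSpectrum (𝓞 P.F), P.W.HasMultiplicativeReductionAt v → ¬ ((l : ℤ) ∣ P.localHeight v))
    (hcyc : P.AdmitsLCyclic l) :
    5 * ((l : ℝ) * P.degInf) ≤ 8 * P.htInf + 48 * Real.log l + 313 := by
  haveI : Fact l.Prime := ⟨hl⟩
  obtain ⟨W', hW', g, hdeg⟩ := P.exists_isogeny_of_admitsLCyclic hl hcyc
  -- the quotient `E_H`, presented over the same field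
  set P' : EllPoint := @EllPoint.mk P.F _ _ W' hW' with hP'
  -- (a) Faltings' isogeny inequality
  have hF : P'.htFalt ≤ P.htFalt + 1 / 2 * Real.log l := by
    have h := WeierstrassCurve.stableFaltingsHeight_le_of_isogeny_holds P.W W' g
    rw [hdeg] at h
    exact h
  -- (b) `deg_∞(E_H) = l · deg_∞(E)`
  have hD : P'.degInf = l * P.degInf := by
    have hideal := WeierstrassCurve.Isogeny.jDenominatorIdeal_eq_pow_of_degree_eq_prime g hdeg
      (P.not_dvd_log_valuation_j_of_isSemistable hss hcop)
    show (P'.degree : ℝ)⁻¹ * Real.log (Ideal.absNorm W'.jDenominatorIdeal) =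
      l * ((P.degree : ℝ)⁻¹ * Real.log (Ideal.absNorm P.W.jDenominatorIdeal))
    have hdd : P'.degree = P.degree := rfl
    rw [hdd, hideal, map_pow, Nat.cast_pow, Real.log_pow]
    ring
  -- (c) Silverman 1986 Prop. 2.1, explicit: upper inequality at `E_H`, lower inequality at `E`
  have hS' : P'.htInf ≤ 12 * P'.htFalt + 6 * Real.log (1 + P'.htInf) + 37 :=
    jHeight_le_stableFaltingsHeight_explicit P.F W'
  have hS : P.htFalt ≤ 1 / 12 * (P.htInf - 9) := stableFaltingsHeight_le_logHeight₁ P.W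
  -- (d) `deg_∞(E_H) ≤ ht_∞(E_H)` and the absorption of the logarithm
  have h1 : P'.degInf ≤ P'.htInf := P'.degInf_le_htInf
  have hx0 : 0 ≤ P'.htInf := mul_nonneg (inv_nonneg.mpr (Nat.cast_nonneg _)) (zero_le_logHeight₁ _)
  have hlog := six_mul_log_one_add_le hx0
  rw [hD] at h1
  linarith

/-! ## (B) [IUTchIV] Cor. 2.2 (ii), (P4) ⇒ (P6): the fixed-point explicit form -/

/-- **(P6) from ONE explicit inequality** ([IUTchIV] Cor. 2.2 (ii), (P4) ⇒ (P6), pointwise): for `λ ∈ U_X`, a prime `l ≥ 7` with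
(P2) and (P5), if `8·ht_∞(λ) + 48·log l + 313 < 5·l·log q^∀(λ)` then `Cor22.CondP6 P l` — for every theta-field `F` the Legendre
curve `E_F` (semistable, `F/F_tpd` Galois of degree `∣ 46080`) admits no `l`-cyclic subgroup scheme (the explicit Lemma 3.5
`mul_degInf_le_of_admitsLCyclic` with `ht_∞([E_F]) = ht_∞(λ)`, `log q^∀(λ) ≤ deg_∞([E_F])`, and "(P2) ⇒ `l` prime to the local
heights" — `htInf_eq_htInfty`, `logQForall_le_degInf_thetaEllPoint`, `not_dvd_localHeight_of_condP2`), whence the image of Galois on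
`E_F[l]` contains `SL₂(𝔽_l)` by the Tate transvection at the (P5) place (`imageModLContainsSL2_of_condP5`, [GenEll] Lem. 3.1 (iii)).
[cite: Mochizuki2012, IUTchIV Cor. 2.2 (ii) proof (P4)–(P6) pp. 45–46] [cite: MochizukiGenEll2010, Lem. 3.1 (iii) p. 14]
[claim: Mochizuki2012, status: disputed] -/
theorem condP6_of_isogenyHeight {P : NFPoint} {l : ℕ} (hl : l.Prime) (h7 : 7 ≤ l)
    (hP2 : CondP2 P l) (hP5 : CondP5 P l)
    (hineq : 8 * htInfty P + 48 * Real.log l + 313 < 5 * ((l : ℝ) * logQForall P)) : CondP6 P l := by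
  intro hU F _ _ _ hF _
  haveI : Fact l.Prime := ⟨hl⟩
  letI iA : Algebra P.F (thetaEllPoint P hU F).F := ‹Algebra P.F F›
  haveI iG : IsGalois P.F (thetaEllPoint P hU F).F := hF.isGalois
  have hdeg : Module.finrank P.F (thetaEllPoint P hU F).F ∣ 46080 := hF.finrank_dvd
  have hj : (thetaEllPoint P hU F).W.j = algebraMap P.F (thetaEllPoint P hU F).F (jInv P.x) :=
    thetaCurve_j F hU
  have hss : (thetaEllPoint P hU F).IsSemistable := hF.isSemistable
  refine imageModLContainsSL2_of_condP5 (thetaEllPoint P hU F) hj hdeg hss h7 hP2 hP5 ?_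
  intro hcyc
  have hA := mul_degInf_le_of_admitsLCyclic (thetaEllPoint P hU F) hl hss
    (not_dvd_localHeight_of_condP2 (thetaEllPoint P hU F) hj hdeg hl h7 hP2) hcyc
  rw [htInf_eq_htInfty (thetaEllPoint P hU F) hj] at hA
  have hq : logQForall P ≤ (thetaEllPoint P hU F).degInf := logQForall_le_degInf_thetaEllPoint F hU
  have hl0 : (0 : ℝ) ≤ l := Nat.cast_nonneg _
  have := mul_le_mul_of_nonneg_left hq hl0
  linarith

/-! ## (C) The tail form at the Frey–Legendre point of an abc triple -/

/-- `log l ≤ log lo + (l − lo)/lo` for `0 < lo ≤ l` (`log(l/lo) ≤ l/lo − 1`). [folklore] -/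
theorem log_le_log_add_div {lo l : ℝ} (hlo : 0 < lo) (hl : lo ≤ l) :
    Real.log l ≤ Real.log lo + (l - lo) / lo := by
  have h := Real.log_le_sub_one_of_pos (div_pos (lt_of_lt_of_le hlo hl) hlo)
  rw [Real.log_div (lt_of_lt_of_le hlo hl).ne' hlo.ne'] at h
  have : (l - lo) / lo = l / lo - 1 := by field_simp
  linarith

/-- **(P6) at EVERY prime `l ≥ lo` of the Frey–Legendre point `λ = a/c` of an abc triple, from ONE inequality of naturals**:
if `abc = 2^k·m` with `m` odd (`m = (abc)_odd = ordCompl[2](abc)`, `Nat.ordCompl_pow_mul_of_not_dvd`), `7 ≤ lo` and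
`2^516·c^48·lo^48 < m^(10·lo)`, then for every prime `l ≥ lo` with
(P2) and (P5), `Cor22.CondP6 (ratPoint (a/c)) l`. Indeed `8·ht_∞(a/c) ≤ 48·log c + 8·log 256` (`htInfty_ratPoint_triple_le`),
`5·l·log q^∀ ≥ 10·l·log (abc)_odd` (`two_mul_log_oddPart_le_logQNotTwo`, `logQAvoid_anti`), `313 < 452·log 2`, and the
inequality propagates from `lo` to `l ≥ lo` because `48·log l ≤ 48·log lo + 48·(l − lo)/lo` while the right side grows by
`10·(l − lo)·log (abc)_odd ≥ 48·(l − lo)/lo` (`((abc)_odd)^lo ≥ 2^7`). [cite: Mochizuki2012, IUTchIV Cor. 2.2 (ii) proof (P4)–(P6) pp. 45–46]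
[claim: Mochizuki2012, status: disputed] -/
theorem condP6_ratPoint_triple_tail {a b c : ℕ} (h : IsABCTriple a b c) (k m : ℕ) (hkm : a * b * c = 2 ^ k * m)
    (hodd : ¬ 2 ∣ m) (lo : ℕ) (h7 : 7 ≤ lo) (hcrit : 2 ^ 516 * c ^ 48 * lo ^ 48 < m ^ (10 * lo)) :
    ∀ l, l.Prime → lo ≤ l → CondP2 (ratPoint ((a : ℚ) / c)) l → CondP5 (ratPoint ((a : ℚ) / c)) l →
      CondP6 (ratPoint ((a : ℚ) / c)) l := by
  intro l hl hlo hP2 hP5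
  have hc : 0 < c := by obtain ⟨ha, hb, habc, -⟩ := h; omega
  have hoddPart : ordCompl[2] (a * b * c) = m := by
    rw [hkm]; exact Nat.ordCompl_pow_mul_of_not_dvd k Nat.prime_two hodd
  have hm1 : 1 ≤ m := by
    rcases Nat.eq_zero_or_pos m with h0 | h0
    · exact absurd (h0 ▸ dvd_zero 2) hodd
    · exact h0
  -- real logarithms of the data
  have hlo0 : (0 : ℝ) < lo := by exact_mod_cast (show 0 < lo by omega)
  have hlol : (lo : ℝ) ≤ l := by exact_mod_cast hlo
  have hc1 : (1 : ℝ) ≤ c := by exact_mod_cast hc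
  have hm1R : (1 : ℝ) ≤ m := by exact_mod_cast hm1
  have hlogm : 0 ≤ Real.log m := Real.log_nonneg hm1R
  have h2 := Real.log_two_gt_d9
  -- the criterion in logarithms: `516 log 2 + 48 log c + 48 log lo < 10 lo log m`
  have hcritR : 516 * Real.log 2 + 48 * Real.log c + 48 * Real.log lo < 10 * lo * Real.log m := by
    have hlt : ((2 ^ 516 * c ^ 48 * lo ^ 48 : ℕ) : ℝ) < ((m ^ (10 * lo) : ℕ) : ℝ) := by exact_mod_cast hcrit
    have hposL : (0 : ℝ) < ((2 ^ 516 * c ^ 48 * lo ^ 48 : ℕ) : ℝ) := by positivity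
    have hlog := Real.log_lt_log hposL hlt
    -- casts and logarithms rewritten by hand (no numeral evaluation of `2^516`)
    rw [Nat.cast_mul, Nat.cast_mul, Nat.cast_pow, Nat.cast_pow, Nat.cast_pow, Nat.cast_pow,
      Real.log_mul (by positivity) (by positivity), Real.log_mul (by positivity) (by positivity),
      Real.log_pow, Real.log_pow, Real.log_pow, Real.log_pow] at hlog
    push_cast at hlog
    linarith
  -- the slope: `48 ≤ 10 lo log m` (from `m^(10 lo) > 2^516 ≥ 2^70`)
  have hslope : 48 ≤ 10 * lo * Real.log m := by
    have hlogc : 0 ≤ Real.log c := Real.log_nonneg hc1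
    have hloglo : 0 ≤ Real.log lo := Real.log_nonneg (by exact_mod_cast (show 1 ≤ lo by omega))
    nlinarith
  -- `8 ht_∞ ≤ 48 log c + 64 log 2`
  have hH : 8 * htInfty (ratPoint ((a : ℚ) / c)) ≤ 48 * Real.log c + 64 * Real.log 2 := by
    have hh := htInfty_ratPoint_triple_le h
    have h256 : Real.log 256 = 8 * Real.log 2 := by
      rw [show (256 : ℝ) = 2 ^ 8 by norm_num, Real.log_pow]; norm_num
    linarith
  -- `2 log m ≤ log q^∀`
  have hQ : 2 * Real.log m ≤ logQForall (ratPoint ((a : ℚ) / c)) := by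
    have hq2 := two_mul_log_oddPart_le_logQNotTwo h
    rw [hoddPart] at hq2
    have hanti : logQNotTwo (ratPoint ((a : ℚ) / c)) ≤ logQForall (ratPoint ((a : ℚ) / c)) := by
      unfold logQNotTwo logQForall
      exact logQAvoid_anti _ (Finset.empty_subset _)
    linarith
  -- propagate from `lo` to `l`
  have hlogl := log_le_log_add_div hlo0 hlol
  have hl0 : (0 : ℝ) ≤ l := Nat.cast_nonneg _
  refine condP6_of_isogenyHeight hl (le_trans h7 hlo) hP2 hP5 ?_
  have hkey : 48 * Real.log l + 516 * Real.log 2 + 48 * Real.log c < 10 * l * Real.log m := by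
    have hdl : 0 ≤ (l : ℝ) - lo := by linarith
    have e1 : 48 * Real.log l ≤ 48 * Real.log lo + 48 * ((l : ℝ) - lo) / lo := by
      have := mul_le_mul_of_nonneg_left hlogl (by norm_num : (0 : ℝ) ≤ 48)
      rw [mul_add] at this
      linarith [show 48 * (((l : ℝ) - lo) / lo) = 48 * ((l : ℝ) - lo) / lo by ring]
    have e2 : 48 * ((l : ℝ) - lo) / lo ≤ 10 * ((l : ℝ) - lo) * Real.log m := by
      rw [div_le_iff₀ hlo0]
      nlinarith
    nlinarith
  have hmul := mul_le_mul_of_nonneg_left hQ hl0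
  nlinarith

end FreyP6Engine

namespace FreyAdm

open NumberField IsDedekindDomain Literature.IUT.LogVolume Literature.IUT.LogVolume.Cor22
open Literature.NumberTheory.DiophantineGeometry Literature.NumberTheory.DiophantineGeometry.GenEll
open Literature.NumberTheory.DiophantineGeometry.UniformABCConjecture Rat.HeightOneSpectrum
open Summit.ABC.ABC.Theorems

/-- **INHABITED datum types on the WHOLE TAIL `l ≥ lo` of the axis of an abc triple, NO certificates.** For an abc triple `a + b = c`
with `(abc)² = ∏_{p ∈ Il} p^{e_p}`, `AdmitsCore` (rational check), `lo ≥ 7` ABOVE every `e_p` (so (P2), (P5) hold at every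
`l ≥ lo` structurally, two odd primes in `Il`), the odd part `m` of `abc = 2^k·m`, and the ONE inequality
`2^516·c^48·lo^48 < m^(10·lo)` of the isogeny–height engine (`FreyP6Engine.condP6_ratPoint_triple_tail` ⇒ (P6) at every prime `l ≥ lo`): for EVERY prime `l ≥ lo`
the datum type `Cor22.ThetaVolumeDatumAt (ratPoint (a/c)) l` is INHABITED — the interval theorem
`nonempty_thetaVolumeDatumAt_triple_interval` (route's proved `ThetaPartII.stub_thetaData`) on `[lo, l]`. The INFINITE side of a
carrier's axis in one application. [cite: Mochizuki2012, IUTchIV Cor. 2.2 (ii) proof (P7) p. 46] [claim: Mochizuki2012, status: disputed] -/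
theorem nonempty_thetaVolumeDatumAt_triple_tail {a b c : ℕ} (h : IsABCTriple a b c) {Il : List ℕ} {e : ℕ → ℕ}
    (hI : ∀ p ∈ Il, p.Prime) (hnd : Il.Nodup) (he : ∀ p ∈ Il, e p ≠ 0)
    (hD : (a * b * c) ^ 2 = (Il.map fun p => p ^ e p).prod)
    (hne : ∀ r ∈ coreExceptionalJ, ((256 * (c * b + a * a) ^ 3 : ℕ) : ℚ) / (((a * b * c) ^ 2 : ℕ) : ℚ) ≠ r)
    (lo : ℕ) (h7 : 7 ≤ lo) (hsmall : ∀ p ∈ Il, e p < lo)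
    (p₁ p₂ : ℕ) (hp₁ : p₁ ∈ Il) (hp₂ : p₂ ∈ Il) (hp₁2 : p₁ ≠ 2) (hp₂2 : p₂ ≠ 2) (h12 : p₁ ≠ p₂)
    (k m : ℕ) (hkm : a * b * c = 2 ^ k * m) (hodd : ¬ 2 ∣ m) (hcrit : 2 ^ 516 * c ^ 48 * lo ^ 48 < m ^ (10 * lo)) :
    ∀ l, l.Prime → lo ≤ l → Nonempty (ThetaVolumeDatumAt (ratPoint ((a : ℚ) / c)) l) := by
  intro l hlp hlo
  have htail := FreyP6Engine.condP6_ratPoint_triple_tail h k m hkm hodd lo h7 hcrit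
  refine nonempty_thetaVolumeDatumAt_triple_interval h hI hnd he hD hne lo l (by omega) hsmall p₁ p₂ hp₁ hp₂ hp₁2 hp₂2 h12
    ?_ l hlp hlo le_rfl
  intro l' hl' hlo' _
  have hl2 : ∀ p ∈ Il, p ≠ 2 → ¬ l' ∣ e p := by
    intro p hp _ hdvd
    have := Nat.le_of_dvd (Nat.pos_of_ne_zero (he p hp)) hdvd
    have := hsmall p hp
    omega
  have hl8 : 2 ∈ Il → 8 < e 2 → ¬ l' ∣ (e 2 - 8) := by
    intro h2 h8 hdvd
    have := Nat.le_of_dvd (by omega) hdvd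
    have := hsmall 2 h2
    omega
  have hP2 : CondP2 (ratPoint ((a : ℚ) / c)) l' := condP2_triple h hI hnd he hD hl2 hl8
  by_cases hp₁l : p₁ = l'
  · have hp₂l : p₂ ≠ l' := fun h' => h12 (hp₁l.trans h'.symm)
    exact htail l' hl' hlo' hP2 (condP5_triple h hI hnd he hD hl' hp₂ hp₂2 hp₂l)
  · exact htail l' hl' hlo' hP2 (condP5_triple h hI hnd he hD hl' hp₁ hp₁2 hp₁l)

/-- **INHABITED datum types on the WHOLE AXIS `l ≥ lo`, `l ∉ Ex` of an abc triple, NO certificates, NO other file.** As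
`nonempty_thetaVolumeDatumAt_triple_tail`, but (P2) is discharged STRUCTURALLY only above a bound `B > e_p` and, for the finitely
many primes `lo ≤ l < B`, by two decidable hypotheses `hdecOdd` / `hdecTwo` naming the honest (P2) exclusion list `Ex` (the primes
`lo ≤ l < B` dividing some `e_p`, `p` odd, or `e_2 − 8`): for EVERY prime `l ≥ lo` off `Ex` the datum type `Cor22.ThetaVolumeDatumAt (ratPoint (a/c)) l`
is INHABITED — `UP` (W-ref-3), `AdmitsCore`, (P2)/(P5) (`condP2_triple`, `condP5_triple`), (P6) by the isogeny–height criterion at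
`lo` (`FreyP6Engine.condP6_ratPoint_triple_tail`), and the route's proved `ThetaPartII.stub_thetaData`. With `lo = 7` this is a
carrier's ENTIRE admissible axis in one theorem. [cite: Mochizuki2012, IUTchIV Cor. 2.2 (ii) proof (P2)(P5)(P6)(P7) pp. 45–46]
[claim: Mochizuki2012, status: disputed] -/
theorem nonempty_thetaVolumeDatumAt_triple_axis {a b c : ℕ} (h : IsABCTriple a b c) {Il : List ℕ} {e : ℕ → ℕ}
    (hI : ∀ p ∈ Il, p.Prime) (hnd : Il.Nodup) (he : ∀ p ∈ Il, e p ≠ 0)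
    (hD : (a * b * c) ^ 2 = (Il.map fun p => p ^ e p).prod)
    (hne : ∀ r ∈ coreExceptionalJ, ((256 * (c * b + a * a) ^ 3 : ℕ) : ℚ) / (((a * b * c) ^ 2 : ℕ) : ℚ) ≠ r)
    (lo : ℕ) (h7 : 7 ≤ lo) (B : ℕ) (hB : ∀ p ∈ Il, e p < B) (Ex : List ℕ)
    (hdecOdd : ∀ p ∈ Il, p ≠ 2 → ∀ l < B, lo ≤ l → l ∣ e p → l.Prime → l ∈ Ex)
    (hdecTwo : 2 ∈ Il → 8 < e 2 → ∀ l < B, lo ≤ l → l ∣ (e 2 - 8) → l.Prime → l ∈ Ex)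
    (p₁ p₂ : ℕ) (hp₁ : p₁ ∈ Il) (hp₂ : p₂ ∈ Il) (hp₁2 : p₁ ≠ 2) (hp₂2 : p₂ ≠ 2) (h12 : p₁ ≠ p₂)
    (k m : ℕ) (hkm : a * b * c = 2 ^ k * m) (hodd : ¬ 2 ∣ m) (hcrit : 2 ^ 516 * c ^ 48 * lo ^ 48 < m ^ (10 * lo)) :
    ∀ l, l.Prime → lo ≤ l → l ∉ Ex → Nonempty (ThetaVolumeDatumAt (ratPoint ((a : ℚ) / c)) l) := by
  intro l hlp hlo hex
  have htail := FreyP6Engine.condP6_ratPoint_triple_tail h k m hkm hodd lo h7 hcrit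
  have hP2 : CondP2 (ratPoint ((a : ℚ) / c)) l := by
    by_cases hlB : l < B
    · exact condP2_triple h hI hnd he hD (fun p hp hp2 hdvd => hex (hdecOdd p hp hp2 l hlB hlo hdvd hlp))
        (fun h2 h8 hdvd => hex (hdecTwo h2 h8 l hlB hlo hdvd hlp))
    · refine condP2_triple h hI hnd he hD ?_ ?_
      · intro p hp _ hdvd
        have := Nat.le_of_dvd (Nat.pos_of_ne_zero (he p hp)) hdvd
        have := hB p hp
        omega
      · intro h2 h8 hdvd
        have := Nat.le_of_dvd (by omega) hdvd
        have := hB 2 h2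
        omega
  by_cases hp₁l : p₁ = l
  · have hp₂l : p₂ ≠ l := fun h' => h12 (hp₁l.trans h'.symm)
    have hP5 := condP5_triple h hI hnd he hD hlp hp₂ hp₂2 hp₂l
    exact ThetaPartII.stub_thetaData (ratPoint ((a : ℚ) / c)) (FreyRef.ratPoint_triple_mem_UP h) l hlp (by omega)
      (admitsCore_triple h hne) hP2 hP5 (htail l hlp hlo hP2 hP5)
  · have hP5 := condP5_triple h hI hnd he hD hlp hp₁ hp₁2 hp₁l
    exact ThetaPartII.stub_thetaData (ratPoint ((a : ℚ) / c)) (FreyRef.ratPoint_triple_mem_UP h) l hlp (by omega)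
      (admitsCore_triple h hne) hP2 hP5 (htail l hlp hlo hP2 hP5)

end FreyAdm

end Summit.ABC.IUTFork.Conditional

end
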